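import Mathlib.RepresentationTheory.Basic
import Mathlib.LinearAlgebra.Quotient.Basic
import Mathlib.LinearAlgebra.Prod
import Mathlib.Algebra.Module.Projective
import Literature.RepresentationTheory.OneCocycleExtension
import HarnessLib

/-!
# First-order deformation of an invariant submodule: the block cocycle, the window of the jet module, «deforms ⟺ coboundary» («JET-WINDOW»)

Generic representation theory over a commutative ring `k` (any monoid `G`), Mathlib-only (`Representation k G V`,
`Representation.subrepresentation`, `Representation.quotient`), THEOREMS ONLY (no `def`, no instance, no named fact).

THE SITUATION.  A first-order deformation pair `(π₀, π₁)` on ONE module `V` — `π₀ : Representation k G V`, `π₁ : G → End_k V`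
with `π₁ 1 = 0` and the Leibniz rule `π₁ (g h) = π₁ g ∘ π₀ h + π₀ g ∘ π₁ h` (so `π₀ + s π₁` is a representation mod `s²`; letters of
the tree's `FirstOrderJetIntertwiner`, whose JET MODULE is `V × V` with `g · (v₀, v₁) = (π₀ g v₀, π₁ g v₀ + π₀ g v₁)`) — and a
`π₀`-INVARIANT submodule `A ≤ V` (`∀ g, A ≤ A.comap (π₀ g)`), with the sub-representation `π₀|_A` on `A` and the quotient representation
`π̄₀` on `V ⧸ A`.

* §1 **THE BLOCK COCYCLE** `c̄ g := mkQ_A ∘ π₁ g ∘ ι_A : A →ₗ V ⧸ A` (the `A → V ⧸ A` block of the derivative): `c̄ 1 = 0` and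
  `c̄ (g h) = π̄₀ g ∘ c̄ h + c̄ g ∘ π₀|_A h` (`jetBlock_one`, `jetBlock_isCocycle`) — a Hom-valued 1-cocycle for the pair
  (`ρ := π̄₀` on `U := V ⧸ A`, `ρ' := π₀|_A` on `U' := A`) in the exact letters of `OneCocycleExtension`.
* §2 **THE WINDOW.**  The window `fst⁻¹(A) = A × V` of the jet module is invariant (`prod_top_le_comap_jet`) and maps ONTO the cocycle
  extension `E_{c̄}` on `(V ⧸ A) × A`, `E g (u, a) = (π̄₀ g u + c̄ g a, π₀|_A g a)`, by `(a, v) ↦ (mkQ v, a)`, equivariantly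
  (`fst_cocycleRep_mk_eq`, `snd_cocycleRep_mk_eq`), with kernel `0 × A` (`mk_prod_eq_zero_iff`) and onto (`exists_mk_prod_eq`).  So the
  sub-quotient `fst⁻¹(A) ∕ (0 × A)` of the jet module — an extension of `(A, π₀|_A)` (quotient, by `fst`) by `(V ⧸ A, π̄₀)` (sub,
  `(0 × V) ∕ (0 × A)`) — IS `E_{c̄}`.  (Mind the swap: the QUOTIENT representation of `π₀` is the SUB of the window and vice versa.)
* §3 **«`A` DEFORMS TO FIRST ORDER» ⟺ «`c̄` IS A COBOUNDARY».**  `A` deforms to first order along `(π₀, π₁)` when for some `k`-linear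
  `L : A → V` the submodule `A_L := {(a, L a + a') : a, a' ∈ A}` of the jet module (the graph of `L` thickened by `s A`) is invariant,
  i.e. (`deforms_iff_graph_invariant`) `π₁ g a + π₀ g (L a) - L (π₀ g a) ∈ A` for all `g`, `a`.  Then `c̄` is the coboundary of
  `t := mkQ ∘ L` (`jetBlock_coboundary_of_deforms`); conversely a coboundary `c̄ g = t ∘ π₀|_A g - π̄₀ g ∘ t` whose `t` LIFTS to
  `L : A → V` gives a deformation (`deforms_of_jetBlock_coboundary`), and the lift exists whenever `A` is `k`-projective — e.g. `k` a
  field (`exists_lift_mkQ`, `deforms_iff_jetBlock_coboundary`).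
* §4 CONSEQUENCE with `OneCocycleExtension` §2 («split ⟺ coboundary»): the window extension `E_{c̄}` has an equivariant section of its
  quotient map `snd` iff `A` deforms to first order (`exists_equivariant_section_iff_deforms`); `exists_representation_jetBlock` supplies
  `E_{c̄}` from `(π₀, π₁, A)`.

USE (where the consumer meets it; nothing of it is formalised here).  For a family `s ↦ I_s` of representations on one space with
`I₀` reducible and `A ⊂ I₀` an irreducible invariant subspace, a self-extension of `A` cut out of the jet module lives in the window; §3–§4
say it splits iff `A` survives to first order inside the family — the «first-order non-degeneracy» test.  The analytic input deciding
that test in the principal-series setting (simple zero of the Plancherel factor ∕ regularity of normalised intertwining operators at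
the reducibility point) stays in print [Keys1984, §3 pp. 118–119].

SOURCES (what is formalised, read at our letters).  The block-cocycle description of first-order deformations of a sub-object along a
deformation of the ambient object is the standard one: [HuybrechtsLehn1997, App. 2.A.7 (Flags of subsheaves)] — a deformation of a flag
is a unipotent lower-triangular change of frame `b = 1 + β` making the deformed operator `b⁻¹ d b` filtration-preserving; the
off-diagonal block of the deformed operator is a 1-cocycle with values in `Hom(sub, quotient)` and the flag deforms iff its class
vanishes, the admissible `β` forming a torsor — and [HuybrechtsLehn1997, App. 2.A.8] (comparison with the extension class).  Here the
«complex» is a `k[G]`-module, `d_A = π₀ + s π₁`, `β = L`, and «class vanishes» is spelled «coboundary» as in [Brown1982, Ch. IV §2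
pp. 88–89] (splittings ↔ derivations, change of splitting ↔ principal derivation), whose extension dictionary is the tree's
`OneCocycleExtension`.  Deliberately NOT here: `Ext¹`∕`H¹` as objects, higher-order obstructions, topology, and anything specific to the
groups where this is applied.
-/

set_option autoImplicit false

namespace Literature.RepresentationTheory

variable {k : Type*} [CommRing k] {G : Type*} [Monoid G] {V : Type*} [AddCommGroup V] [Module k V]

/-! ## §1 The block cocycle of an invariant submodule -/

omit [Monoid G] in
/-- The block `c̄ g = mkQ_A ∘ π₁ g ∘ ι_A` evaluated: `c̄ g a = [π₁ g a] ∈ V ⧸ A`.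
[cite: HuybrechtsLehn1997, App. 2.A.7 (Flags of subsheaves)] -/
theorem jetBlock_apply (π₁ : G → Module.End k V) (A : Submodule k V) (c : G → A →ₗ[k] V ⧸ A)
    (hc : ∀ g, c g = A.mkQ ∘ₗ π₁ g ∘ₗ A.subtype) (g : G) (a : A) :
    c g a = Submodule.Quotient.mk (π₁ g (a : V)) := by
  rw [hc]
  rfl

/-- `c̄ 1 = 0` (from `π₁ 1 = 0`). [cite: HuybrechtsLehn1997, App. 2.A.7 (Flags of subsheaves)] -/
theorem jetBlock_one (π₁ : G → Module.End k V) (h1 : π₁ 1 = 0) (A : Submodule k V) (c : G → A →ₗ[k] V ⧸ A)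
    (hc : ∀ g, c g = A.mkQ ∘ₗ π₁ g ∘ₗ A.subtype) : c 1 = 0 := by
  rw [hc, h1, LinearMap.zero_comp, LinearMap.comp_zero]

/-- **THE BLOCK IS A 1-COCYCLE.**  For a first-order deformation pair `(π₀, π₁)` (Leibniz rule) and a `π₀`-invariant submodule `A`,
the block `c̄ g = mkQ_A ∘ π₁ g ∘ ι_A : A → V ⧸ A` satisfies `c̄ (g h) = π̄₀ g ∘ c̄ h + c̄ g ∘ π₀|_A h` — the cocycle identity of
`OneCocycleExtension` for the pair (`π̄₀` on `V ⧸ A`, `π₀|_A` on `A`).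
[cite: HuybrechtsLehn1997, App. 2.A.7 (Flags of subsheaves)] [cite: Brown1982, Ch. IV §2 pp. 88–89] -/
theorem jetBlock_isCocycle (π₀ : Representation k G V) (π₁ : G → Module.End k V)
    (hL : ∀ g h, π₁ (g * h) = π₁ g * π₀ h + π₀ g * π₁ h) (A : Submodule k V) (hA : ∀ g, A ≤ A.comap (π₀ g))
    (c : G → A →ₗ[k] V ⧸ A) (hc : ∀ g, c g = A.mkQ ∘ₗ π₁ g ∘ₗ A.subtype) (g h : G) :
    c (g * h) = π₀.quotient A hA g ∘ₗ c h + c g ∘ₗ π₀.subrepresentation A hA h := by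
  ext a
  rw [LinearMap.add_apply, LinearMap.comp_apply, LinearMap.comp_apply, jetBlock_apply π₁ A c hc,
    jetBlock_apply π₁ A c hc, jetBlock_apply π₁ A c hc, hL, LinearMap.add_apply, Module.End.mul_apply,
    Module.End.mul_apply, Representation.quotient_apply, Submodule.mapQ_apply, Representation.subrepresentation_apply,
    LinearMap.coe_restrict_apply, Submodule.Quotient.mk_add, add_comm]

/-! ## §2 The window of the jet module and its model `E_{c̄}` -/

/-- **THE WINDOW IS INVARIANT.**  In the jet module `ρ` of `(π₀, π₁)` (`ρ g (v₀, v₁) = (π₀ g v₀, π₁ g v₀ + π₀ g v₁)`), the window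
`fst⁻¹(A) = A × V` over a `π₀`-invariant `A` is `ρ`-invariant. [cite: HuybrechtsLehn1997, App. 2.A.7 (Flags of subsheaves)] -/
theorem prod_top_le_comap_jet (π₀ : Representation k G V) (π₁ : G → Module.End k V) (ρ : Representation k G (V × V))
    (hρ : ∀ g v₀ v₁, ρ g (v₀, v₁) = (π₀ g v₀, π₁ g v₀ + π₀ g v₁)) (A : Submodule k V) (hA : ∀ g, A ≤ A.comap (π₀ g))
    (g : G) : A.prod ⊤ ≤ (A.prod ⊤).comap (ρ g) := by
  rintro ⟨v₀, v₁⟩ hx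
  rw [Submodule.mem_prod] at hx
  rw [Submodule.mem_comap, hρ, Submodule.mem_prod]
  exact ⟨hA g hx.1, Submodule.mem_top⟩

/-- **EXISTENCE OF THE MODEL `E_{c̄}`.**  For a first-order deformation pair `(π₀, π₁)` and a `π₀`-invariant `A` there is a representation
on `(V ⧸ A) × A` acting by `(u, a) ↦ (π̄₀ g u + c̄ g a, π₀|_A g a)` — the cocycle extension of `OneCocycleExtension` §1 for the block
cocycle. [cite: HuybrechtsLehn1997, App. 2.A.7 (Flags of subsheaves)] [cite: Brown1982, Ch. IV §2 Prop. 2.1 p. 87] -/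
theorem exists_representation_jetBlock (π₀ : Representation k G V) (π₁ : G → Module.End k V) (h1 : π₁ 1 = 0)
    (hL : ∀ g h, π₁ (g * h) = π₁ g * π₀ h + π₀ g * π₁ h) (A : Submodule k V) (hA : ∀ g, A ≤ A.comap (π₀ g))
    (c : G → A →ₗ[k] V ⧸ A) (hc : ∀ g, c g = A.mkQ ∘ₗ π₁ g ∘ₗ A.subtype) :
    ∃ E : Representation k G ((V ⧸ A) × A),
      ∀ g u a, E g (u, a) = (π₀.quotient A hA g u + c g a, π₀.subrepresentation A hA g a) :=
  exists_representation_of_cocycle (π₀.quotient A hA) (π₀.subrepresentation A hA) c (jetBlock_one π₁ h1 A c hc)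
    (jetBlock_isCocycle π₀ π₁ hL A hA c hc)

/-- **THE WINDOW MAPS EQUIVARIANTLY ONTO `E_{c̄}` — first component.**  For `a ∈ A`, `v ∈ V`, the map `(a, v) ↦ (mkQ v, a)` satisfies
`(E g (mkQ v, a)).1 = mkQ ((ρ g (a, v)).2)`. [cite: HuybrechtsLehn1997, App. 2.A.7 (Flags of subsheaves)] -/
theorem fst_cocycleRep_mk_eq (π₀ : Representation k G V) (π₁ : G → Module.End k V) (ρ : Representation k G (V × V))
    (hρ : ∀ g v₀ v₁, ρ g (v₀, v₁) = (π₀ g v₀, π₁ g v₀ + π₀ g v₁)) (A : Submodule k V) (hA : ∀ g, A ≤ A.comap (π₀ g))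
    (c : G → A →ₗ[k] V ⧸ A) (hc : ∀ g, c g = A.mkQ ∘ₗ π₁ g ∘ₗ A.subtype) (E : Representation k G ((V ⧸ A) × A))
    (hE : ∀ g u a, E g (u, a) = (π₀.quotient A hA g u + c g a, π₀.subrepresentation A hA g a)) (g : G) (a : A) (v : V) :
    (E g (Submodule.Quotient.mk v, a)).1 = Submodule.Quotient.mk (ρ g ((a : V), v)).2 := by
  rw [hE, hρ]
  dsimp only
  rw [Representation.quotient_apply, Submodule.mapQ_apply, jetBlock_apply π₁ A c hc, Submodule.Quotient.mk_add, add_comm]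

/-- **THE WINDOW MAPS EQUIVARIANTLY ONTO `E_{c̄}` — second component.**  `((E g (mkQ v, a)).2 : V) = (ρ g (a, v)).1`.
[cite: HuybrechtsLehn1997, App. 2.A.7 (Flags of subsheaves)] -/
theorem snd_cocycleRep_mk_eq (π₀ : Representation k G V) (π₁ : G → Module.End k V) (ρ : Representation k G (V × V))
    (hρ : ∀ g v₀ v₁, ρ g (v₀, v₁) = (π₀ g v₀, π₁ g v₀ + π₀ g v₁)) (A : Submodule k V) (hA : ∀ g, A ≤ A.comap (π₀ g))
    (c : G → A →ₗ[k] V ⧸ A) (E : Representation k G ((V ⧸ A) × A))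
    (hE : ∀ g u a, E g (u, a) = (π₀.quotient A hA g u + c g a, π₀.subrepresentation A hA g a)) (g : G) (a : A) (v : V) :
    ((E g (Submodule.Quotient.mk v, a)).2 : V) = (ρ g ((a : V), v)).1 := by
  rw [hE, hρ]
  dsimp only
  rw [Representation.subrepresentation_apply, LinearMap.coe_restrict_apply]

/-- The KERNEL of `(a, v) ↦ (mkQ v, a)` on the window is `0 × A`: `(mkQ v, a) = 0 ↔ a = 0 ∧ v ∈ A`.
[cite: HuybrechtsLehn1997, App. 2.A.7 (Flags of subsheaves)] -/
theorem mk_prod_eq_zero_iff (A : Submodule k V) (a : A) (v : V) :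
    ((Submodule.Quotient.mk v : V ⧸ A), a) = (0 : (V ⧸ A) × A) ↔ a = 0 ∧ v ∈ A := by
  rw [Prod.mk_eq_zero, Submodule.Quotient.mk_eq_zero, and_comm]

/-- The map `(a, v) ↦ (mkQ v, a)` from the window is ONTO `(V ⧸ A) × A`. [cite: HuybrechtsLehn1997, App. 2.A.7 (Flags of subsheaves)] -/
theorem exists_mk_prod_eq (A : Submodule k V) (x : (V ⧸ A) × A) :
    ∃ a : A, ∃ v : V, ((Submodule.Quotient.mk v : V ⧸ A), a) = x := by
  obtain ⟨u, a⟩ := x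
  obtain ⟨v, rfl⟩ := Submodule.mkQ_surjective A u
  exact ⟨a, v, rfl⟩

/-! ## §3 «`A` deforms to first order» ⟺ «the block cocycle is a coboundary» -/

/-- **DEFORMATION CONDITION ⟺ INVARIANCE OF THE THICKENED GRAPH.**  For `k`-linear `L : A → V`, the condition
`π₁ g a + π₀ g (L a) - L (π₀ g a) ∈ A` (all `g`, `a`) says exactly that the submodule `A_L = {(a, L a + a') : a, a' ∈ A}` of the jet
module is `ρ`-invariant: `ρ g (a, L a + a') = (b, L b + b')` for some `b, b' ∈ A`.
[cite: HuybrechtsLehn1997, App. 2.A.7 (Flags of subsheaves)] -/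
theorem deforms_iff_graph_invariant (π₀ : Representation k G V) (π₁ : G → Module.End k V) (ρ : Representation k G (V × V))
    (hρ : ∀ g v₀ v₁, ρ g (v₀, v₁) = (π₀ g v₀, π₁ g v₀ + π₀ g v₁)) (A : Submodule k V) (hA : ∀ g, A ≤ A.comap (π₀ g))
    (L : A →ₗ[k] V) :
    (∀ g (a : A), π₁ g (a : V) + π₀ g (L a) - L (π₀.subrepresentation A hA g a) ∈ A) ↔
      ∀ g (a a' : A), ∃ b b' : A, ρ g ((a : V), L a + a') = ((b : V), L b + b') := by
  constructor
  · intro H g a a'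
    have hmem : π₁ g (a : V) + π₀ g (L a) - L (π₀.subrepresentation A hA g a) + π₀ g (a' : V) ∈ A :=
      A.add_mem (H g a) (Submodule.mem_comap.mp (hA g a'.2))
    refine ⟨π₀.subrepresentation A hA g a, ⟨_, hmem⟩, ?_⟩
    rw [hρ]
    refine Prod.ext ?_ ?_
    · change π₀ g (a : V) = ((π₀.subrepresentation A hA g a : A) : V)
      rw [Representation.subrepresentation_apply, LinearMap.coe_restrict_apply]
    · change π₁ g (a : V) + π₀ g (L a + (a' : V)) = L (π₀.subrepresentation A hA g a) +
        (π₁ g (a : V) + π₀ g (L a) - L (π₀.subrepresentation A hA g a) + π₀ g (a' : V))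
      rw [map_add]
      abel
  · intro H g a
    obtain ⟨b, b', hbb'⟩ := H g a 0
    rw [hρ, Submodule.coe_zero, add_zero, Prod.mk.injEq] at hbb'
    have hb : π₀.subrepresentation A hA g a = b := by
      apply Subtype.ext
      rw [Representation.subrepresentation_apply, LinearMap.coe_restrict_apply, hbb'.1]
    rw [hb, hbb'.2, add_sub_cancel_left]
    exact b'.2

/-- **DEFORMS ⟹ COBOUNDARY.**  If `A` deforms to first order via `L : A → V` then the block cocycle is the coboundary of `t = mkQ ∘ L`:
`c̄ g = t ∘ π₀|_A g - π̄₀ g ∘ t` (the «coboundary» shape of `OneCocycleExtension` §2). Any commutative ring `k`.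
[cite: HuybrechtsLehn1997, App. 2.A.7 (Flags of subsheaves)] [cite: Brown1982, Ch. IV §2 pp. 88–89] -/
theorem jetBlock_coboundary_of_deforms (π₀ : Representation k G V) (π₁ : G → Module.End k V) (A : Submodule k V)
    (hA : ∀ g, A ≤ A.comap (π₀ g)) (c : G → A →ₗ[k] V ⧸ A) (hc : ∀ g, c g = A.mkQ ∘ₗ π₁ g ∘ₗ A.subtype) (L : A →ₗ[k] V)
    (hdef : ∀ g (a : A), π₁ g (a : V) + π₀ g (L a) - L (π₀.subrepresentation A hA g a) ∈ A) (g : G) :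
    c g = (A.mkQ ∘ₗ L) ∘ₗ π₀.subrepresentation A hA g - π₀.quotient A hA g ∘ₗ (A.mkQ ∘ₗ L) := by
  ext a
  rw [jetBlock_apply π₁ A c hc, LinearMap.sub_apply, LinearMap.comp_apply, LinearMap.comp_apply, LinearMap.comp_apply,
    LinearMap.comp_apply, Submodule.mkQ_apply, Submodule.mkQ_apply, Representation.quotient_apply, Submodule.mapQ_apply,
    ← Submodule.Quotient.mk_sub, Submodule.Quotient.eq]
  have h := hdef g a
  rwa [show π₁ g (a : V) + π₀ g (L a) - L (π₀.subrepresentation A hA g a) =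
      π₁ g (a : V) - (L (π₀.subrepresentation A hA g a) - π₀ g (L a)) by abel] at h

/-- **COBOUNDARY WITH A LIFT ⟹ DEFORMS.**  If the block cocycle is a coboundary, `c̄ g = t ∘ π₀|_A g - π̄₀ g ∘ t`, and `t : A → V ⧸ A`
lifts to `L : A → V` (`mkQ ∘ L = t`), then `A` deforms to first order via `L`. Any commutative ring `k`.
[cite: HuybrechtsLehn1997, App. 2.A.7 (Flags of subsheaves)] [cite: Brown1982, Ch. IV §2 pp. 88–89] -/
theorem deforms_of_jetBlock_coboundary (π₀ : Representation k G V) (π₁ : G → Module.End k V) (A : Submodule k V)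
    (hA : ∀ g, A ≤ A.comap (π₀ g)) (c : G → A →ₗ[k] V ⧸ A) (hc : ∀ g, c g = A.mkQ ∘ₗ π₁ g ∘ₗ A.subtype)
    (t : A →ₗ[k] V ⧸ A) (ht : ∀ g, c g = t ∘ₗ π₀.subrepresentation A hA g - π₀.quotient A hA g ∘ₗ t) (L : A →ₗ[k] V)
    (hLt : A.mkQ ∘ₗ L = t) (g : G) (a : A) :
    π₁ g (a : V) + π₀ g (L a) - L (π₀.subrepresentation A hA g a) ∈ A := by
  subst hLt
  have h := LinearMap.congr_fun (ht g) a
  rw [jetBlock_apply π₁ A c hc, LinearMap.sub_apply, LinearMap.comp_apply, LinearMap.comp_apply, LinearMap.comp_apply,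
    LinearMap.comp_apply, Submodule.mkQ_apply, Submodule.mkQ_apply, Representation.quotient_apply, Submodule.mapQ_apply,
    ← Submodule.Quotient.mk_sub, Submodule.Quotient.eq] at h
  rwa [show π₁ g (a : V) - (L (π₀.subrepresentation A hA g a) - π₀ g (L a)) =
      π₁ g (a : V) + π₀ g (L a) - L (π₀.subrepresentation A hA g a) by abel] at h

/-- **LIFTS EXIST FOR PROJECTIVE `A`.**  If `A` is a projective `k`-module (e.g. `k` a field) every `t : A → V ⧸ A` lifts along `mkQ`.
[cite: HuybrechtsLehn1997, App. 2.A.7 (Flags of subsheaves)] -/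
theorem exists_lift_mkQ (A : Submodule k V) [Module.Projective k A] (t : A →ₗ[k] V ⧸ A) :
    ∃ L : A →ₗ[k] V, A.mkQ ∘ₗ L = t :=
  Module.projective_lifting_property _ _ (Submodule.mkQ_surjective A)

/-- **«`A` DEFORMS TO FIRST ORDER» ⟺ «THE BLOCK COCYCLE IS A COBOUNDARY»** (for `A` projective over `k`, e.g. `k` a field):
`(∃ L : A → V, ∀ g a, π₁ g a + π₀ g (L a) - L (π₀ g a) ∈ A) ↔ ∃ t : A → V ⧸ A, ∀ g, c̄ g = t ∘ π₀|_A g - π̄₀ g ∘ t`.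
[cite: HuybrechtsLehn1997, App. 2.A.7 (Flags of subsheaves)] [cite: Brown1982, Ch. IV §2 Prop. 2.3 p. 89] -/
theorem deforms_iff_jetBlock_coboundary (π₀ : Representation k G V) (π₁ : G → Module.End k V) (A : Submodule k V)
    [Module.Projective k A] (hA : ∀ g, A ≤ A.comap (π₀ g)) (c : G → A →ₗ[k] V ⧸ A)
    (hc : ∀ g, c g = A.mkQ ∘ₗ π₁ g ∘ₗ A.subtype) :
    (∃ L : A →ₗ[k] V, ∀ g (a : A), π₁ g (a : V) + π₀ g (L a) - L (π₀.subrepresentation A hA g a) ∈ A) ↔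
      ∃ t : A →ₗ[k] V ⧸ A, ∀ g, c g = t ∘ₗ π₀.subrepresentation A hA g - π₀.quotient A hA g ∘ₗ t := by
  constructor
  · rintro ⟨L, hdef⟩
    exact ⟨A.mkQ ∘ₗ L, jetBlock_coboundary_of_deforms π₀ π₁ A hA c hc L hdef⟩
  · rintro ⟨t, ht⟩
    obtain ⟨L, hLt⟩ := exists_lift_mkQ A t
    exact ⟨L, deforms_of_jetBlock_coboundary π₀ π₁ A hA c hc t ht L hLt⟩

/-! ## §4 Consequence: the window extension splits iff `A` deforms to first order -/

/-- **THE WINDOW SPLITS ⟺ `A` DEFORMS TO FIRST ORDER** (for `A` projective over `k`, e.g. `k` a field).  The model `E_{c̄}` of the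
sub-quotient `fst⁻¹(A) ∕ (0 × A)` of the jet module — an extension of `(A, π₀|_A)` by `(V ⧸ A, π̄₀)` — admits an equivariant
`k`-linear section of its quotient map `snd` iff `A` deforms to first order along `(π₀, π₁)`; by `OneCocycleExtension` §2 («split ⟺
coboundary») and §3. [cite: HuybrechtsLehn1997, App. 2.A.7 (Flags of subsheaves)] [cite: Brown1982, Ch. IV §2 Prop. 2.3 p. 89] -/
theorem exists_equivariant_section_iff_deforms (π₀ : Representation k G V) (π₁ : G → Module.End k V) (A : Submodule k V)
    [Module.Projective k A] (hA : ∀ g, A ≤ A.comap (π₀ g)) (c : G → A →ₗ[k] V ⧸ A)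
    (hc : ∀ g, c g = A.mkQ ∘ₗ π₁ g ∘ₗ A.subtype) (E : Representation k G ((V ⧸ A) × A))
    (hE : ∀ g u a, E g (u, a) = (π₀.quotient A hA g u + c g a, π₀.subrepresentation A hA g a)) :
    (∃ s : A →ₗ[k] (V ⧸ A) × A, (∀ a, (s a).2 = a) ∧ ∀ g a, E g (s a) = s (π₀.subrepresentation A hA g a)) ↔
      ∃ L : A →ₗ[k] V, ∀ g (a : A), π₁ g (a : V) + π₀ g (L a) - L (π₀.subrepresentation A hA g a) ∈ A :=
  (exists_equivariant_section_iff_coboundary (π₀.quotient A hA) (π₀.subrepresentation A hA) c E hE).trans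
    (deforms_iff_jetBlock_coboundary π₀ π₁ A hA c hc).symm

/-- **NON-DEGENERACY FORM** (contrapositive packaging for the consumer): if `A` does NOT deform to first order — no `L : A → V` with
`π₁ g a + π₀ g (L a) - L (π₀ g a) ∈ A` for all `g, a` — then the window extension `E_{c̄}` has NO equivariant section: it is a non-split
extension of `(A, π₀|_A)` by `(V ⧸ A, π̄₀)`. [cite: HuybrechtsLehn1997, App. 2.A.7 (Flags of subsheaves)] -/
theorem not_exists_equivariant_section_of_not_deforms (π₀ : Representation k G V) (π₁ : G → Module.End k V)
    (A : Submodule k V) [Module.Projective k A] (hA : ∀ g, A ≤ A.comap (π₀ g)) (c : G → A →ₗ[k] V ⧸ A)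
    (hc : ∀ g, c g = A.mkQ ∘ₗ π₁ g ∘ₗ A.subtype) (E : Representation k G ((V ⧸ A) × A))
    (hE : ∀ g u a, E g (u, a) = (π₀.quotient A hA g u + c g a, π₀.subrepresentation A hA g a))
    (hnd : ¬ ∃ L : A →ₗ[k] V, ∀ g (a : A), π₁ g (a : V) + π₀ g (L a) - L (π₀.subrepresentation A hA g a) ∈ A) :
    ¬ ∃ s : A →ₗ[k] (V ⧸ A) × A, (∀ a, (s a).2 = a) ∧ ∀ g a, E g (s a) = s (π₀.subrepresentation A hA g a) :=
  fun hs => hnd ((exists_equivariant_section_iff_deforms π₀ π₁ A hA c hc E hE).mp hs)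

end Literature.RepresentationTheory
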